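import Mathlib
import Summits.PneNP.PneNP.Theses.OneSlice
import Summits.PneNP.PneNP.Theorems.OneSliceSliceTargetSplit
import Summits.PneNP.PneNP.Theorems.OneSliceMonotoneContinuationSamplerExpansion
import Summits.PneNP.PneNP.Theorems.OneSliceMonotoneContinuationTransportMono

/-!
# Route OneSlice, crux `MonotoneContinuation` (stmt-PneNP-18471), line `Sketch_ideator1_r1` (ProfileLine) — stub delMixture_expand

Bookkeeping for the uniform-size deletion `y := x ∧ ¬ρ`, `x` of weight `i`, `ρ` of weight `a` (pure double
counting, valid for every real-valued `Φ`). For fixed `x` the sum over `ρ ∈ slice n a` is grouped by the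
landing point `y = x ∧ ¬ρ ⊆ x` (`Finset.sum_fiberwise_of_maps_to`); as edge sets, `x ∧ ¬ρ = y` says exactly
`supp x \ supp y ⊆ supp ρ ⊆ (supp y)ᶜ` (`delMixture_meet_eq_iff`), so the fibre over a `y` of weight `i - l`
is a squeezed slice of size `C(C(n,2) - i, a - l)` for `l ≤ a` and is empty for `l > a`
(`delMixture_card_fibre`, through `stub_transportMono_card_between`). On the other side the level sum
`Σ_{l ≤ i} Σ_{y ∈ slice (i-l)}` is one sum over the `y` of weight `≤ i` (`Finset.sum_fiberwise_of_maps_to` along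
`y ↦ i - e(y) ≤ i`), and for such `y` the neighbourhood `nbhd i y` is the set of weight-`i` vectors `x` with
`supp y ⊆ supp x`; the two double sums over the nested pairs `(y, x)` are then exchanged by `Finset.sum_comm'`.
-/

set_option linter.dupNamespace false -- `Summit.PneNP.PneNP.…`: summit = sub-problem (D-0017)

namespace Summit.PneNP.PneNP.Theorems.MonotoneContinuation

open Literature.Computability.Complexity hiding supp mem_supp
open Finset hiding slice
open Filter hiding mem_sdiff
open Classical
open Summit.PneNP.PneNP.Theorems (binomialWeight_tail_le binomialWeight_sum_range binomialWeight_nonneg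
  binomialWeight_variance card_slice)
open Summit.PneNP.PneNP.Theorems.ConstantBand.Negative (Edge thr Central slice)
open Summit.PneNP.PneNP.Theorems.SingleThreshold.Negative (pc)
open Summit.PneNP.PneNP.Theorems.SliceACZero.Negative (supp mem_supp card_supp supp_injective supp_indicator)
open Summit.PneNP.PneNP.Theorems.SliceTargetSplit (Comp nbhd mem_nbhd transport ind l1 nbhdCard card_nbhd
  card_nbhd_of_le card_nbhd_of_ge choose_mul_nbhdCard nbhdCard_pos sum_slice_sum_nbhd sum_slice_sum_nbhd_left
  supp_subset_of_comp_of_le comp_iff_supp comp_comm ofSet supp_ofSet ofSet_supp edgeCount_ofSet ind_nonneg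
  ind_le_one abs_ind_sub_ind l1_triangle l1_comm l1_nonneg transport_nonneg transport_sub)

noncomputable section

variable {n : ℕ}

/-! ### The fibres of `ρ ↦ x ∧ ¬ρ` -/

/-- The support of `x ∧ ¬ρ` is the difference of the supports. [folklore] -/
theorem delMixture_supp_diff (x ρ : Edge n → Bool) : supp (fun e => x e && !ρ e) = supp x \ supp ρ := by
  ext e
  simp only [mem_supp, mem_sdiff, Bool.and_eq_true, Bool.not_eq_true', Bool.eq_false_iff, ne_eq]

/-- For `y ⊆ x` (as edge sets), `x ∧ ¬ρ = y` says exactly `x \ y ⊆ ρ ⊆ yᶜ`. [folklore] -/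
theorem delMixture_meet_eq_iff {x y ρ : Edge n → Bool} (hyx : supp y ⊆ supp x) :
    (fun e => x e && !ρ e) = y ↔ supp x \ supp y ⊆ supp ρ ∧ supp ρ ⊆ (supp y)ᶜ := by
  rw [← supp_injective.eq_iff, delMixture_supp_diff]
  constructor
  · intro h
    refine ⟨fun e he => ?_, fun e he => ?_⟩
    · rw [mem_sdiff, ← h, mem_sdiff] at he
      by_contra hρ
      exact he.2 ⟨he.1, hρ⟩
    · rw [mem_compl, ← h, mem_sdiff]
      exact fun h' => h'.2 he
  · rintro ⟨h1, h2⟩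
    ext e
    rw [mem_sdiff]
    constructor
    · rintro ⟨hx, hρ⟩
      by_contra hy
      exact hρ (h1 (mem_sdiff.2 ⟨hx, hy⟩))
    · intro hy
      exact ⟨hyx hy, fun hρ => (mem_compl.1 (h2 hρ)) hy⟩

/-- **Deletion fibres at fixed size.** For `y ⊆ x` (as edge sets), the number of weight-`a` vectors `ρ` with
`x ∧ ¬ρ = y` is `C(C(n,2) - e(x), a - (e(x) - e(y)))` if `e(x) - e(y) ≤ a` and `0` otherwise: such a `ρ` is
`x \ y` together with an arbitrary `(a - (e(x) - e(y)))`-subset of the complement of `x`. [folklore] -/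
theorem delMixture_card_fibre (a : ℕ) {x y : Edge n → Bool} (hyx : supp y ⊆ supp x) :
    #((slice n a).filter fun ρ => (fun e => x e && !ρ e) = y) =
      if edgeCount x - edgeCount y ≤ a then
        (n.choose 2 - edgeCount x).choose (a - (edgeCount x - edgeCount y)) else 0 := by
  have hfilter : (slice n a).filter (fun ρ => (fun e => x e && !ρ e) = y) =
      (slice n a).filter (fun ρ => supp x \ supp y ⊆ supp ρ ∧ supp ρ ⊆ (supp y)ᶜ) :=
    filter_congr fun ρ _ => delMixture_meet_eq_iff hyx
  have hU : #(supp x \ supp y) = edgeCount x - edgeCount y := by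
    rw [card_sdiff_of_subset hyx, card_supp, card_supp]
  have hV : #((supp y)ᶜ) = n.choose 2 - edgeCount y := by
    rw [card_compl, card_edgeSet_top_fin, card_supp]
  have hle : edgeCount y ≤ edgeCount x := by
    rw [← card_supp, ← card_supp]
    exact card_le_card hyx
  have hxN : edgeCount x ≤ n.choose 2 := samplerExpansion_edgeCount_le x
  have hUV : supp x \ supp y ⊆ (supp y)ᶜ := fun e he => mem_compl.2 (mem_sdiff.1 he).2
  rw [hfilter]
  split_ifs with h
  · rw [stub_transportMono_card_between hUV (by rwa [hU]), hU, hV]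
    congr 1
    omega
  · rw [card_eq_zero, filter_eq_empty_iff]
    rintro ρ hρ ⟨h1, -⟩
    have h' := card_le_card h1
    rw [hU, card_supp, (mem_filter.1 hρ).2] at h'
    exact h h'

/-- The sum over `ρ ∈ slice n a` of a function of `x ∧ ¬ρ`, grouped by the landing point `y = x ∧ ¬ρ ⊆ x`:
each `y` is hit `C(C(n,2) - e(x), a - (e(x) - e(y)))` times (`0` times if `e(x) - e(y) > a`). [folklore] -/
theorem delMixture_inner (a : ℕ) (Φ : (Edge n → Bool) → (Edge n → Bool) → ℝ) (x : Edge n → Bool) :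
    ∑ ρ ∈ slice n a, Φ x (fun e => x e && !ρ e) =
      ∑ y ∈ univ.filter (fun y : Edge n → Bool => supp y ⊆ supp x),
        (if edgeCount x - edgeCount y ≤ a then
            (((n.choose 2 - edgeCount x).choose (a - (edgeCount x - edgeCount y)) : ℕ) : ℝ) else 0) * Φ x y := by
  rw [← sum_fiberwise_of_maps_to (s := slice n a) (t := univ.filter (fun y : Edge n → Bool => supp y ⊆ supp x))
    (g := fun ρ : Edge n → Bool => fun e => x e && !ρ e)]
  · refine sum_congr rfl fun y hy => ?_
    have hyx : supp y ⊆ supp x := (mem_filter.1 hy).2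
    calc ∑ ρ ∈ (slice n a) with (fun e => x e && !ρ e) = y, Φ x (fun e => x e && !ρ e)
        = ∑ ρ ∈ (slice n a) with (fun e => x e && !ρ e) = y, Φ x y := by
          refine sum_congr rfl fun ρ hρ => ?_
          have hρy : (fun e => x e && !ρ e) = y := (mem_filter.1 hρ).2
          rw [show Φ x (fun e => x e && !ρ e) = Φ x y from congrArg (Φ x) hρy]
      _ = _ := by
          rw [sum_const, nsmul_eq_mul, delMixture_card_fibre a hyx, Nat.cast_ite, Nat.cast_zero]
  · intro ρ _
    rw [mem_filter]
    refine ⟨mem_univ _, fun e he => ?_⟩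
    rw [mem_supp] at he ⊢
    rw [Bool.and_eq_true] at he
    exact he.1

/-- The slice `i - l`, `l ≤ i`, is the fibre of `y ↦ i - e(y)` over `l` among the vectors of weight `≤ i`.
[folklore] -/
theorem delMixture_slice_eq_filter {i l : ℕ} (hl : l ≤ i) :
    (univ.filter (fun y : Edge n → Bool => edgeCount y ≤ i)).filter (fun y => i - edgeCount y = l) =
      slice n (i - l) := by
  ext y
  simp only [slice, mem_filter, mem_univ, true_and]
  omega

/-! ### The registered stub -/

/-- **DelMixture** (stub `delMixture_expand` of line `Sketch_ideator1_r1`, bridge `MC → flat-below`, D2). With `x`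
uniform on the slice `i` and `ρ` uniform of weight `a`, the pair `(x, x ∧ ¬ρ)` expands over the landing levels
`i - l`: every nested pair `(y, x)`, `x` of weight `i` above `y` of weight `i - l` (i.e. `x ∈ nbhd i y`), is
produced by exactly `C(C(n,2) - i, a - l)` vectors `ρ` if `l ≤ a` and by none otherwise; `Φ` arbitrary.
[folklore] -/
theorem delMixture_expand :
  ∀ (n i a : ℕ) (Φ : (Edge n → Bool) → (Edge n → Bool) → ℝ),
    ∑ x ∈ slice n i, ∑ ρ ∈ slice n a, Φ x (fun e => x e && !ρ e) =
      ∑ l ∈ range (i + 1), (if l ≤ a then (((n.choose 2 - i).choose (a - l) : ℕ) : ℝ) else 0) *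
        ∑ y ∈ slice n (i - l), ∑ x ∈ nbhd i y, Φ x y := by
  intro n i a Φ
  -- left: group `ρ` by the landing point `y = x ∧ ¬ρ ⊆ x`
  have lhs : ∑ x ∈ slice n i, ∑ ρ ∈ slice n a, Φ x (fun e => x e && !ρ e) =
      ∑ x ∈ slice n i, ∑ y ∈ univ.filter (fun y : Edge n → Bool => supp y ⊆ supp x),
        (if i - edgeCount y ≤ a then (((n.choose 2 - i).choose (a - (i - edgeCount y)) : ℕ) : ℝ) else 0) *
          Φ x y := by
    refine sum_congr rfl fun x hx => ?_
    have hxi : edgeCount x = i := (mem_filter.1 hx).2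
    rw [delMixture_inner a Φ x, hxi]
  -- right: one sum over the `y` of weight `≤ i`, the coefficient pushed inside
  have rhs : (∑ l ∈ range (i + 1), (if l ≤ a then (((n.choose 2 - i).choose (a - l) : ℕ) : ℝ) else 0) *
        ∑ y ∈ slice n (i - l), ∑ x ∈ nbhd i y, Φ x y) =
      ∑ y ∈ univ.filter (fun y : Edge n → Bool => edgeCount y ≤ i), ∑ x ∈ nbhd i y,
        (if i - edgeCount y ≤ a then (((n.choose 2 - i).choose (a - (i - edgeCount y)) : ℕ) : ℝ) else 0) *
          Φ x y := by
    calc (∑ l ∈ range (i + 1), (if l ≤ a then (((n.choose 2 - i).choose (a - l) : ℕ) : ℝ) else 0) *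
          ∑ y ∈ slice n (i - l), ∑ x ∈ nbhd i y, Φ x y)
        = ∑ l ∈ range (i + 1),
            ∑ y ∈ (univ.filter (fun y : Edge n → Bool => edgeCount y ≤ i)) with i - edgeCount y = l,
              ∑ x ∈ nbhd i y,
                (if i - edgeCount y ≤ a then (((n.choose 2 - i).choose (a - (i - edgeCount y)) : ℕ) : ℝ)
                  else 0) * Φ x y := by
          refine sum_congr rfl fun l hl => ?_
          have hli : l ≤ i := Nat.lt_succ_iff.1 (mem_range.1 hl)
          rw [mul_sum]
          refine sum_congr (delMixture_slice_eq_filter hli).symm fun y hy => ?_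
          rw [mul_sum, (mem_filter.1 hy).2]
      _ = _ := by
          refine sum_fiberwise_of_maps_to (fun y _ => ?_) _
          rw [mem_range, Nat.lt_succ_iff]
          exact Nat.sub_le i _
  rw [lhs, rhs]
  -- exchange the two sums over the nested pairs `y ⊆ x`, `e(x) = i`
  refine sum_comm' fun x y => ?_
  simp only [slice, mem_filter, mem_univ, true_and, mem_nbhd]
  constructor
  · rintro ⟨hxi, hyx⟩
    have hle : edgeCount y ≤ edgeCount x := by
      rw [← card_supp, ← card_supp]
      exact card_le_card hyx
    exact ⟨⟨hxi, comp_iff_supp.2 (Or.inr hyx)⟩, by omega⟩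
  · rintro ⟨⟨hxi, hc⟩, hyi⟩
    exact ⟨hxi, supp_subset_of_comp_of_le (comp_comm.1 hc) (by omega)⟩

end

end Summit.PneNP.PneNP.Theorems.MonotoneContinuation
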